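import Summits.QuantumFields.YangMills.Theses.TwistExponentGap
import HarnessLib

/-!
# Route `TwistExponentGap` (planner `ym-idea-4` g13, LINE g13-A; DRAFT by design): the assembly item ⟨stmt-QuantumFields-24057⟩

`Assembly := PeriodicToronFloor → RigidTwistCeiling → StratifiedTwistCeiling → MarginalTwistOnset.FixedTorusCriterionFailure` is,
verbatim, the type of the route file's certified deciding theorem `Theses.TwistExponentGap.closes` (real-exponent bookkeeping +
`tendsto_rpow_neg_atTop`, planner-authored via `route open --closes-file`).  This file records that fact BY NAME.

HONEST LABEL: assembly bookkeeping only; the three cruxes (24053 StratifiedTwistCeiling, 24054 RigidTwistCeiling,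
24055 PeriodicToronFloor), the rung R1 leaf `MarginalTwistOnset.FixedTorusCriterionFailure` and the summit are untouched; the
Yang–Mills mass gap is NOT proved.  Width seat `ym-line-sfw-p2-w3` g34 (cell ym-idea-1, free hands). [cite: Thooft1979] [cite: Luscher1983]
-/

set_option autoImplicit false

namespace Summit.QuantumFields.YangMills.Theorems.TwistExponentGap

/-- **Item ⟨stmt-QuantumFields-24057⟩ `TwistExponentGap.Assembly`**, by the route file's certified `closes` theorem.
[cite: Thooft1979] [cite: Luscher1983] -/
theorem assembly_proof : Summit.QuantumFields.YangMills.Theses.TwistExponentGap.Assembly :=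
  fun hF hR hS => Summit.QuantumFields.YangMills.Theses.TwistExponentGap.closes hF hR hS

end Summit.QuantumFields.YangMills.Theorems.TwistExponentGap
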